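import Summits.Ventures.Crystal3D.StickySpheres.OctahedronCaps
import Mathlib.Tactic.Module
import HarnessLib

/-!
# Tetrahedral caps: the tri-capped tetrahedron admits no fourth cap, and a strip of five tetrahedra does not close up

Venture `Crystal3D` (cell `pub-crystal3d`, seat p2). Elementary Euclidean geometry in `ℝ³` by linear algebra, unit
DIAMETER convention (touching centres at distance `1`). Seen from a ball `h`, the centres of the balls touching `h` are
unit vectors, and two of them touch iff their inner product is `1/2`.

* `tetra_reflect` — if `u, v, t` are unit vectors with pairwise inner products `1/2` (a regular tetrahedron at the hub)
  and `s` is a unit vector with `⟪s,u⟫ = ⟪s,v⟫ = 1/2` and `⟪s,t⟫ ≤ 1/2` (the ball `s` touches `h, u, v` and does not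
  overlap `t`), then `s` is the reflection of `t` in the plane `⟨u, v⟩`: `s = (2/3)(u + v) − t`.
* `no_triakis_cap` — tetrahedron `h p q r` with caps `x, y, z` on its three faces at `h`: no ball `w` touches `h, x, y, z`
  (it would need `⟪w − h, r − h⟫ = 3/2 > 1`).
* `no_tetra_strip` — five tetrahedra `h v_i v_{i+1} v_{i+2}` (`i = 0..4`) about a common ball `h`: the end balls
  `v₀, v₆` are at squared distance `256/81`, so they do not touch (`⟪v₀ − h, v₆ − h⟫ = −47/81 ≠ 1/2`).
These are the last two of the five contact patterns on eight balls with nineteen contacts that survive the combinatorial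
filters at `n = 8`; with `OctahedronCaps.lean` they make `C(8) = 18` unconditional (`StickySpheres/ContactEight.lean`).

HONEST FRAMING: folklore solid geometry, formalised; nothing enumerative and nothing about crystallization is claimed.
-/

noncomputable section

open Real RealInnerProductSpace

namespace Summit.Ventures.Crystal3D

/-- **Reflection across a face at the hub.** Unit vectors `u, v, t` with pairwise inner products `1/2`, and a unit
vector `s` with `⟪s, u⟫ = ⟪s, v⟫ = 1/2`, `⟪s, t⟫ ≤ 1/2`: then `s = (2/3)(u + v) − t` (and `⟪s, t⟫ = −1/3`). [folklore] -/
theorem tetra_reflect {u v t s : EuclideanSpace ℝ (Fin 3)} (huu : ⟪u, u⟫ = 1) (hvv : ⟪v, v⟫ = 1) (htt : ⟪t, t⟫ = 1)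
    (hss : ⟪s, s⟫ = 1) (huv : ⟪u, v⟫ = 1 / 2) (hut : ⟪u, t⟫ = 1 / 2) (hvt : ⟪v, t⟫ = 1 / 2) (hsu : ⟪s, u⟫ = 1 / 2)
    (hsv : ⟪s, v⟫ = 1 / 2) (hst : ⟪s, t⟫ ≤ 1 / 2) : s = (2 / 3 : ℝ) • (u + v) - t := by
  have hvu : ⟪v, u⟫ = 1 / 2 := by rw [real_inner_comm]; exact huv
  have htu : ⟪t, u⟫ = 1 / 2 := by rw [real_inner_comm]; exact hut
  have htv : ⟪t, v⟫ = 1 / 2 := by rw [real_inner_comm]; exact hvt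
  have hus : ⟪u, s⟫ = 1 / 2 := by rw [real_inner_comm]; exact hsu
  have hvs : ⟪v, s⟫ = 1 / 2 := by rw [real_inner_comm]; exact hsv
  set τ : ℝ := ⟪s, t⟫ with hτ
  have hts : ⟪t, s⟫ = τ := real_inner_comm _ _
  -- orthogonal frame `u + v`, `u − v`, `u + v − 3t` (squared lengths `3, 1, 6`)
  have h1 : u + v ≠ 0 := by
    intro h
    have e : ⟪u + v, u + v⟫ = 0 := by rw [h, inner_zero_left]
    simp only [inner_add_left, inner_add_right] at e
    linarith
  have h2 : u - v ≠ 0 := by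
    intro h
    have e : ⟪u - v, u - v⟫ = 0 := by rw [h, inner_zero_left]
    simp only [inner_sub_left, inner_sub_right] at e
    linarith
  have h3 : u + v - (t + t + t) ≠ 0 := by
    intro h
    have e : ⟪u + v - (t + t + t), u + v - (t + t + t)⟫ = 0 := by rw [h, inner_zero_left]
    simp only [inner_sub_left, inner_sub_right, inner_add_left, inner_add_right] at e
    linarith
  have o12 : ⟪u + v, u - v⟫ = 0 := by
    simp only [inner_add_left, inner_sub_right]; linarith
  have o13 : ⟪u + v, u + v - (t + t + t)⟫ = 0 := by
    simp only [inner_add_left, inner_sub_right, inner_add_right]; linarith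
  have o23 : ⟪u - v, u + v - (t + t + t)⟫ = 0 := by
    simp only [inner_sub_left, inner_sub_right, inner_add_right]; linarith
  -- coordinates of `s`: `1/3` along `u + v`, `0` along `u − v`, `(1 − 3τ)/6` along `u + v − 3t`
  have hSexp : s = (1 / 3 : ℝ) • (u + v) + ((1 - 3 * τ) / 6) • (u + v - (t + t + t)) := by
    have hz := eq_zero_of_inner_three h1 h2 h3 o12 o13 o23
      (v := s - ((1 / 3 : ℝ) • (u + v) + ((1 - 3 * τ) / 6) • (u + v - (t + t + t)))) ?_ ?_ ?_
    · exact sub_eq_zero.1 hz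
    · simp only [inner_sub_right, inner_add_right, inner_add_left, real_inner_smul_right, hus, hvs, huu, huv, hvu,
        hvv, hut, hvt]
      ring
    · simp only [inner_sub_right, inner_add_right, inner_sub_left, real_inner_smul_right, hus, hvs, huu, huv, hvu,
        hvv, hut, hvt]
      ring
    · simp only [inner_sub_right, inner_add_right, inner_sub_left, inner_add_left, real_inner_smul_right, hus, hvs,
        hts, huu, huv, hvu, hvv, hut, hvt, htu, htv, htt]
      ring
  -- `‖s‖² = 1` in coordinates: `1/3 + (1 − 3τ)²/6 = 1`, i.e. `(3τ + 1)(τ − 1) = 0`; `τ ≤ 1/2` leaves `τ = −1/3`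
  have key : (3 * τ + 1) * (τ - 1) = 0 := by
    have e : ⟪s, s⟫ = ⟪(1 / 3 : ℝ) • (u + v) + ((1 - 3 * τ) / 6) • (u + v - (t + t + t)),
        (1 / 3 : ℝ) • (u + v) + ((1 - 3 * τ) / 6) • (u + v - (t + t + t))⟫ := by rw [← hSexp]
    simp only [inner_sub_left, inner_sub_right, inner_add_left, inner_add_right, real_inner_smul_left,
      real_inner_smul_right, hss, huu, huv, hvu, hvv, hut, hvt, htu, htv, htt] at e
    linear_combination (-2 : ℝ) * e
  have hτv : τ = -1 / 3 := by
    rcases mul_eq_zero.1 key with h | h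
    · linarith
    · exfalso; linarith
  have hr : (1 - 3 * τ) / 6 = (1 / 3 : ℝ) := by rw [hτv]; norm_num
  rw [hr] at hSexp
  rw [hSexp]
  module

/-! ### The tri-capped tetrahedron has no fourth cap -/

/-- **Triakis pattern.** Let `h, p, q, r` be mutually touching balls, `x, y, z` the caps on the faces `hpq`, `hpr`, `hqr`
(each not overlapping the fourth ball), and `w` a ball touching `h, x, y, z`. Impossible: with the hub `h` as origin,
`⟪w, x⟫ = ⟪w, y⟫ = ⟪w, z⟫ = 1/2` forces `⟪w, r⟫ = 3/2 > 1 = ‖w‖ ‖r‖`. [folklore] -/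
theorem no_triakis_cap {h p q r x y z w : EuclideanSpace ℝ (Fin 3)} (hhp : dist h p = 1) (hhq : dist h q = 1)
    (hhr : dist h r = 1) (hpq : dist p q = 1) (hpr : dist p r = 1) (hqr : dist q r = 1) (hxh : dist x h = 1)
    (hxp : dist x p = 1) (hxq : dist x q = 1) (hyh : dist y h = 1) (hyp : dist y p = 1) (hyr : dist y r = 1)
    (hzh : dist z h = 1) (hzq : dist z q = 1) (hzr : dist z r = 1) (hwh : dist w h = 1) (hwx : dist w x = 1)
    (hwy : dist w y = 1) (hwz : dist w z = 1) (hxr : 1 ≤ dist x r) (hyq : 1 ≤ dist y q) (hzp : 1 ≤ dist z p) :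
    False := by
  -- Gram data seen from the hub `h`
  have gUU := inner_sub_sub_of_dist h p p
  have gVV := inner_sub_sub_of_dist h q q
  have gTT := inner_sub_sub_of_dist h r r
  have gUV := inner_sub_sub_of_dist h p q
  have gUT := inner_sub_sub_of_dist h p r
  have gVT := inner_sub_sub_of_dist h q r
  have gXX := inner_sub_sub_of_dist h x x
  have gXU := inner_sub_sub_of_dist h x p
  have gXV := inner_sub_sub_of_dist h x q
  have gXT := inner_sub_sub_of_dist h x r
  have gYY := inner_sub_sub_of_dist h y y
  have gYU := inner_sub_sub_of_dist h y p
  have gYT := inner_sub_sub_of_dist h y r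
  have gYV := inner_sub_sub_of_dist h y q
  have gZZ := inner_sub_sub_of_dist h z z
  have gZV := inner_sub_sub_of_dist h z q
  have gZT := inner_sub_sub_of_dist h z r
  have gZU := inner_sub_sub_of_dist h z p
  have gWW := inner_sub_sub_of_dist h w w
  have gWX := inner_sub_sub_of_dist h w x
  have gWY := inner_sub_sub_of_dist h w y
  have gWZ := inner_sub_sub_of_dist h w z
  have hxr2 : 1 ≤ dist x r ^ 2 := one_le_pow₀ hxr
  have hyq2 : 1 ≤ dist y q ^ 2 := one_le_pow₀ hyq
  have hzp2 : 1 ≤ dist z p ^ 2 := one_le_pow₀ hzp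
  have nW : ‖w - h‖ = 1 := by rw [← dist_eq_norm, hwh]
  have nT : ‖r - h‖ = 1 := by rw [← dist_eq_norm, dist_comm, hhr]
  rw [dist_comm] at hhp hhq hhr
  rw [hhp, hhq, hhr, hpq, hpr, hqr, hxh, hxp, hxq, hyh, hyp, hyr, hzh, hzq, hzr, hwh, hwx, hwy, hwz, dist_self] at *
  set U := p - h with hU
  set V := q - h with hV
  set T := r - h with hT
  set X := x - h with hX
  set Y := y - h with hY
  set Z := z - h with hZ
  set W := w - h with hW
  -- the three caps are reflections of the opposite vertices
  have eX : X = (2 / 3 : ℝ) • (U + V) - T :=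
    tetra_reflect (by rw [gUU]; norm_num) (by rw [gVV]; norm_num) (by rw [gTT]; norm_num) (by rw [gXX]; norm_num)
      (by rw [gUV]; norm_num) (by rw [gUT]; norm_num) (by rw [gVT]; norm_num) (by rw [gXU]; norm_num)
      (by rw [gXV]; norm_num) (by rw [gXT]; linarith)
  have eY : Y = (2 / 3 : ℝ) • (U + T) - V :=
    tetra_reflect (by rw [gUU]; norm_num) (by rw [gTT]; norm_num) (by rw [gVV]; norm_num) (by rw [gYY]; norm_num)
      (by rw [gUT]; norm_num) (by rw [gUV]; norm_num) (by rw [real_inner_comm, gVT]; norm_num) (by rw [gYU]; norm_num)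
      (by rw [gYT]; norm_num) (by rw [gYV]; linarith)
  have eZ : Z = (2 / 3 : ℝ) • (V + T) - U :=
    tetra_reflect (by rw [gVV]; norm_num) (by rw [gTT]; norm_num) (by rw [gUU]; norm_num) (by rw [gZZ]; norm_num)
      (by rw [gVT]; norm_num) (by rw [real_inner_comm, gUV]; norm_num) (by rw [real_inner_comm, gUT]; norm_num)
      (by rw [gZV]; norm_num) (by rw [gZT]; norm_num) (by rw [gZU]; linarith)
  -- the three cap contacts of `w` force `⟪W, T⟫ = 3/2`
  rw [eX] at gWX
  rw [eY] at gWY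
  rw [eZ] at gWZ
  simp only [inner_sub_right, inner_add_right, real_inner_smul_right] at gWX gWY gWZ
  have hWT : ⟪W, T⟫ = 3 / 2 := by linarith
  have hle : ⟪W, T⟫ ≤ ‖W‖ * ‖T‖ := real_inner_le_norm _ _
  rw [nW, nT] at hle
  linarith

/-! ### A strip of five tetrahedra about a common ball does not close up -/

/-- **Strip pattern.** Seven balls `v₀,…,v₆` touch a common ball `h`; consecutive ones and next-to-consecutive ones touch
(five tetrahedra `h v_i v_{i+1} v_{i+2}` sharing faces), and `v_i, v_{i+3}` do not overlap. Then `v₀` and `v₆` do not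
touch: `⟪v₀ − h, v₆ − h⟫ = −47/81 ≠ 1/2`. [folklore] -/
theorem no_tetra_strip {h v0 v1 v2 v3 v4 v5 v6 : EuclideanSpace ℝ (Fin 3)} (h0 : dist h v0 = 1) (h1 : dist h v1 = 1)
    (h2 : dist h v2 = 1) (h3 : dist h v3 = 1) (h4 : dist h v4 = 1) (h5 : dist h v5 = 1) (h6 : dist h v6 = 1)
    (h01 : dist v0 v1 = 1) (h12 : dist v1 v2 = 1) (h23 : dist v2 v3 = 1) (h34 : dist v3 v4 = 1) (h45 : dist v4 v5 = 1)
    (h56 : dist v5 v6 = 1) (h02 : dist v0 v2 = 1) (h13 : dist v1 v3 = 1) (h24 : dist v2 v4 = 1) (h35 : dist v3 v5 = 1)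
    (h46 : dist v4 v6 = 1) (h06 : dist v0 v6 = 1) (h03 : 1 ≤ dist v0 v3) (h14 : 1 ≤ dist v1 v4)
    (h25 : 1 ≤ dist v2 v5) (h36 : 1 ≤ dist v3 v6) : False := by
  -- Gram data seen from the hub `h`
  have g00 := inner_sub_sub_of_dist h v0 v0
  have g11 := inner_sub_sub_of_dist h v1 v1
  have g22 := inner_sub_sub_of_dist h v2 v2
  have g33 := inner_sub_sub_of_dist h v3 v3
  have g44 := inner_sub_sub_of_dist h v4 v4
  have g55 := inner_sub_sub_of_dist h v5 v5
  have g66 := inner_sub_sub_of_dist h v6 v6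
  have g01 := inner_sub_sub_of_dist h v0 v1
  have g12 := inner_sub_sub_of_dist h v1 v2
  have g23 := inner_sub_sub_of_dist h v2 v3
  have g34 := inner_sub_sub_of_dist h v3 v4
  have g45 := inner_sub_sub_of_dist h v4 v5
  have g56 := inner_sub_sub_of_dist h v5 v6
  have g02 := inner_sub_sub_of_dist h v0 v2
  have g13 := inner_sub_sub_of_dist h v1 v3
  have g24 := inner_sub_sub_of_dist h v2 v4
  have g35 := inner_sub_sub_of_dist h v3 v5
  have g46 := inner_sub_sub_of_dist h v4 v6
  have g06 := inner_sub_sub_of_dist h v0 v6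
  have g03 := inner_sub_sub_of_dist h v0 v3
  have g14 := inner_sub_sub_of_dist h v1 v4
  have g25 := inner_sub_sub_of_dist h v2 v5
  have g36 := inner_sub_sub_of_dist h v3 v6
  have h03' : 1 ≤ dist v0 v3 ^ 2 := one_le_pow₀ h03
  have h14' : 1 ≤ dist v1 v4 ^ 2 := one_le_pow₀ h14
  have h25' : 1 ≤ dist v2 v5 ^ 2 := one_le_pow₀ h25
  have h36' : 1 ≤ dist v3 v6 ^ 2 := one_le_pow₀ h36
  rw [dist_comm] at h0 h1 h2 h3 h4 h5 h6
  rw [h0, h1, h2, h3, h4, h5, h6, h01, h12, h23, h34, h45, h56, h02, h13, h24, h35, h46, h06, dist_self] at *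
  set U0 := v0 - h
  set U1 := v1 - h
  set U2 := v2 - h
  set U3 := v3 - h
  set U4 := v4 - h
  set U5 := v5 - h
  set U6 := v6 - h
  -- each new ball is the reflection of the ball three steps back
  have e3 : U3 = (2 / 3 : ℝ) • (U1 + U2) - U0 :=
    tetra_reflect (by rw [g11]; norm_num) (by rw [g22]; norm_num) (by rw [g00]; norm_num) (by rw [g33]; norm_num)
      (by rw [g12]; norm_num) (by rw [real_inner_comm, g01]; norm_num) (by rw [real_inner_comm, g02]; norm_num)
      (by rw [real_inner_comm, g13]; norm_num) (by rw [real_inner_comm, g23]; norm_num)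
      (by rw [real_inner_comm, g03]; linarith)
  have e4 : U4 = (2 / 3 : ℝ) • (U2 + U3) - U1 :=
    tetra_reflect (by rw [g22]; norm_num) (by rw [g33]; norm_num) (by rw [g11]; norm_num) (by rw [g44]; norm_num)
      (by rw [g23]; norm_num) (by rw [real_inner_comm, g12]; norm_num) (by rw [real_inner_comm, g13]; norm_num)
      (by rw [real_inner_comm, g24]; norm_num) (by rw [real_inner_comm, g34]; norm_num)
      (by rw [real_inner_comm, g14]; linarith)
  have e5 : U5 = (2 / 3 : ℝ) • (U3 + U4) - U2 :=
    tetra_reflect (by rw [g33]; norm_num) (by rw [g44]; norm_num) (by rw [g22]; norm_num) (by rw [g55]; norm_num)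
      (by rw [g34]; norm_num) (by rw [real_inner_comm, g23]; norm_num) (by rw [real_inner_comm, g24]; norm_num)
      (by rw [real_inner_comm, g35]; norm_num) (by rw [real_inner_comm, g45]; norm_num)
      (by rw [real_inner_comm, g25]; linarith)
  have e6 : U6 = (2 / 3 : ℝ) • (U4 + U5) - U3 :=
    tetra_reflect (by rw [g44]; norm_num) (by rw [g55]; norm_num) (by rw [g33]; norm_num) (by rw [g66]; norm_num)
      (by rw [g45]; norm_num) (by rw [real_inner_comm, g34]; norm_num) (by rw [real_inner_comm, g35]; norm_num)
      (by rw [real_inner_comm, g46]; norm_num) (by rw [real_inner_comm, g56]; norm_num)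
      (by rw [real_inner_comm, g36]; linarith)
  -- inner products of `U0` with the successive balls: −1/3, −7/18, −53/54, −47/81
  have i03 : ⟪U0, U3⟫ = -1 / 3 := by
    rw [e3, inner_sub_right, real_inner_smul_right, inner_add_right, g01, g02, g00]; norm_num
  have i04 : ⟪U0, U4⟫ = -7 / 18 := by
    rw [e4, inner_sub_right, real_inner_smul_right, inner_add_right, g02, i03, g01]; norm_num
  have i05 : ⟪U0, U5⟫ = -53 / 54 := by
    rw [e5, inner_sub_right, real_inner_smul_right, inner_add_right, i03, i04, g02]; norm_num
  have i06 : ⟪U0, U6⟫ = -47 / 81 := by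
    rw [e6, inner_sub_right, real_inner_smul_right, inner_add_right, i04, i05, i03]; norm_num
  rw [i06] at g06
  norm_num at g06

end Summit.Ventures.Crystal3D

end
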